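import Literature.ModelTheory.ExponentialFields.SemialgebraicThickLadders
import Literature.ModelTheory.ExponentialFields.SemialgebraicDimension
import HarnessLib

/-!
# Cuts for a free window (capsule refinement subordinate to an open cover, VI: Part II)

Topic `Literature/ModelTheory/ExponentialFields` — block B2c₃ of the proof of the
`C¹`-triangulation theorem for compact semialgebraic sets
(`Literature.ModelTheory.ExponentialFields.OhmotoShiota2017_c1Triangulation`, statement of
[OhmotoShiota2017, Thm. 1.1]) along the proof of [Pawlucki2024], specialized to `p = 1`.

**The final claim of the proof of [Pawlucki2024, Prop. 2.5] (p. 3872), in rich-cut form**: for a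
free window `[γ, δ]` over `Fr` (block B2c₂) there is a finite family of continuous semialgebraic
cut functions valid (`RCValid γ δ V`) at every point of `Fr`.  As in the source the proof is an
induction on the dimension of the served set `A ⊆ Fr`: a cylindrical decomposition of `ℝᵐ⁺¹`
adapted to the cover, to the graphs of `γ, δ` and to `A`, `Fr` [Dries1998, Ch. 3 (2.11)] gives
over every top-dimensional cell `B ⊆ A` sections `γ = φ₀ < ⋯ < φ_p = δ` whose bands and graphs lie
in single members of the cover (§1); thickening the graphs (§2, "thin bands") yields a ladder all of
whose closed pieces lie in single members; the lower-dimensional cells and the frontiers of the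
top cells are served by induction (a neighbourhood `U_E`), and the thick-ladder construction
(block B2c₁) serves `B ∖ U_E` (§3).

No named facts are introduced (D-0026).

## References

* [Pawlucki2024] W. Pawłucki, *Strict `C^p`-triangulations — a new approach to
  desingularization*, J. Eur. Math. Soc. 26 (2024), 3863–3909, Prop. 2.5, proof, Part II.
* [Dries1998] L. van den Dries, *Tame topology and o-minimal structures*, Ch. 3 (2.11), Ch. 4
  (1.8) (dimension of frontiers).
* [OhmotoShiota2017] T. Ohmoto, M. Shiota, *`C¹`-triangulations of semialgebraic sets*,
  J. Topology 10 (2017), Thm. 1.1 (statement only).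
-/

noncomputable section

open Set Filter Metric
open _root_.Topology

namespace Literature.ModelTheory.ExponentialFields

open Literature.NumberTheory.Transcendental (IsSemialgebraicFunOn IsSemialgebraicMapOn
  isSemialgebraicFunOn_iff isSemialgebraicMapOn_iff_forall_holds)
open Literature.NumberTheory.Transcendental.SemialgebraicMonotonicity (sa_and sa_or sa_not sa_imp
  sa_lt sa_le sa_eq sa_const_lt sa_const_le)

/-! ### §1 Extraction from an adapted cylindrical decomposition -/

section CADExtract

variable {m : ℕ}

/-- A cell of a partition is contained in, or disjoint from, any union of cells. [folklore] -/
theorem subset_or_disjoint_sUnion {α : Type*} {𝒯 : Finset (Set α)} (hpart : Setoid.IsPartition (𝒯 : Set (Set α)))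
    {𝒞 : Finset (Set α)} (h𝒞 : 𝒞 ⊆ 𝒯) {T : Set α} (hT : T ∈ 𝒯) :
    T ⊆ ⋃₀ (𝒞 : Set (Set α)) ∨ Disjoint T (⋃₀ (𝒞 : Set (Set α))) := by
  classical
  by_cases h : T ∈ 𝒞
  · exact Or.inl (subset_sUnion_of_mem h)
  · refine Or.inr (disjoint_sUnion_right.2 fun T' hT' => ?_)
    have hne : T ≠ T' := fun heq => h (heq ▸ hT')
    exact hpart.pairwiseDisjoint hT (h𝒞 hT') hne

variable {l : ℕ}

/-- The fibres of a band are open. [cite: BasuPollackRoy2006, Def. 5.1] -/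
theorem isOpen_band_fibre {S : Set (Fin m → ℝ)} (ξ : Fin l → (Fin m → ℝ) → ℝ) (j : Fin (l + 1)) (x : Fin m → ℝ) :
    IsOpen {t : ℝ | (Fin.snoc x t : Fin (m + 1) → ℝ) ∈ bandOver S ξ j} := by
  by_cases hx : x ∈ S
  · have h : {t : ℝ | (Fin.snoc x t : Fin (m + 1) → ℝ) ∈ bandOver S ξ j} =
        {t : ℝ | bandLower ξ j x < (t : EReal)} ∩ {t : ℝ | (t : EReal) < bandUpper ξ j x} := by
      ext t; simp [hx]
    rw [h]
    exact (isOpen_lt continuous_const continuous_coe_real_ereal).inter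
      (isOpen_lt continuous_coe_real_ereal continuous_const)
  · have h : {t : ℝ | (Fin.snoc x t : Fin (m + 1) → ℝ) ∈ bandOver S ξ j} = ∅ := by
      ext t; simp [hx]
    rw [h]; exact isOpen_empty

/-- A band is not contained in a graph-like set (one point per fibre). [folklore] -/
theorem not_band_subset_graphlike {S : Set (Fin m → ℝ)} {ξ : Fin l → (Fin m → ℝ) → ℝ} {j : Fin (l + 1)}
    {x : Fin m → ℝ} {t₀ : ℝ} (h₀ : (Fin.snoc x t₀ : Fin (m + 1) → ℝ) ∈ bandOver S ξ j)
    {Γ : Set (Fin (m + 1) → ℝ)} (hΓ : ∀ t t', (Fin.snoc x t : Fin (m + 1) → ℝ) ∈ Γ → (Fin.snoc x t' : Fin (m + 1) → ℝ) ∈ Γ → t = t') :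
    ¬ bandOver S ξ j ⊆ Γ := by
  intro hsub
  obtain ⟨ε, hε, hball⟩ := Metric.isOpen_iff.1 (isOpen_band_fibre ξ j x) t₀ h₀
  have h1 : t₀ + ε / 2 ∈ ball t₀ ε := by
    rw [mem_ball, Real.dist_eq, add_sub_cancel_left, abs_of_pos (by linarith)]; linarith
  have h := hΓ t₀ (t₀ + ε / 2) (hsub h₀) (hsub (hball h1))
  linarith

variable {𝒯 : Finset (Set (Fin (m + 1) → ℝ))} {ℬ : Finset (Set (Fin m → ℝ))}
  {L : Set (Fin m → ℝ) → ℕ} {ξ : (S : Set (Fin m → ℝ)) → Fin (L S) → (Fin m → ℝ) → ℝ}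

/-- The stack description of the cells. [cite: BasuPollackRoy2006, Def. 5.1] -/
def IsStackOf (ℬ : Finset (Set (Fin m → ℝ))) (𝒯 : Finset (Set (Fin (m + 1) → ℝ))) (L : Set (Fin m → ℝ) → ℕ)
    (ξ : (S : Set (Fin m → ℝ)) → Fin (L S) → (Fin m → ℝ) → ℝ) : Prop :=
  (∀ S ∈ ℬ, ∀ j, ContinuousOn (ξ S j) S) ∧ (∀ S ∈ ℬ, ∀ j, IsSemialgebraicFunOn ℝ S (ξ S j)) ∧
    (∀ S ∈ ℬ, ∀ x ∈ S, StrictMono fun j => ξ S j x) ∧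
    ∀ T, T ∈ 𝒯 ↔ ∃ S ∈ ℬ, (∃ j, T = graphOver S (ξ S j)) ∨ ∃ j, T = bandOver S (ξ S) j

/-- **Base cells versus cylinder sets**: if `A × ℝ` is a union of cells then every base cell lies in
`A` or misses it. [cite: Dries1998, Ch. 3 (2.11)] -/
theorem base_subset_or_disjoint (hpart : Setoid.IsPartition (𝒯 : Set (Set (Fin (m + 1) → ℝ))))
    (hst : IsStackOf ℬ 𝒯 L ξ) {A : Set (Fin m → ℝ)} {𝒞 : Finset (Set (Fin (m + 1) → ℝ))} (h𝒞 : 𝒞 ⊆ 𝒯)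
    (hA : {z : Fin (m + 1) → ℝ | Fin.init z ∈ A} = ⋃₀ (𝒞 : Set (Set (Fin (m + 1) → ℝ))))
    {S : Set (Fin m → ℝ)} (hS : S ∈ ℬ) : S ⊆ A ∨ Disjoint S A := by
  obtain ⟨hc, -, hmono, hcells⟩ := hst
  -- the bottom band over `S` and a section of it
  have hT : bandOver S (ξ S) 0 ∈ 𝒯 := (hcells _).2 ⟨S, hS, Or.inr ⟨0, rfl⟩⟩
  obtain ⟨s, -, hs⟩ := exists_continuousOn_snoc_mem_bandOver (hc S hS) (hmono S hS) 0
  rcases subset_or_disjoint_sUnion hpart h𝒞 hT with h | h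
  · left
    intro x hx
    have hz := h (hs x hx)
    rw [← hA] at hz
    simpa using hz
  · right
    refine disjoint_left.2 fun x hxS hxA => ?_
    have hz : (Fin.snoc x (s x) : Fin (m + 1) → ℝ) ∈ ⋃₀ (𝒞 : Set (Set (Fin (m + 1) → ℝ))) := by
      rw [← hA]; simpa using hxA
    exact disjoint_left.1 h (hs x hxS) hz

/-- **Identification of a graph with a section**: if the graph of `f` over `W ⊇ S` is a union of cells
then over the base cell `S` it is one of the sections. [cite: Dries1998, Ch. 3 (2.11)] -/
theorem exists_section_eq
    (hℬ : Setoid.IsPartition (ℬ : Set (Set (Fin m → ℝ)))) (hst : IsStackOf ℬ 𝒯 L ξ)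
    {W : Set (Fin m → ℝ)} {f : (Fin m → ℝ) → ℝ} {𝒞 : Finset (Set (Fin (m + 1) → ℝ))} (h𝒞 : 𝒞 ⊆ 𝒯)
    (hΓ : graphOver W f = ⋃₀ (𝒞 : Set (Set (Fin (m + 1) → ℝ))))
    {S : Set (Fin m → ℝ)} (hS : S ∈ ℬ) (hSW : S ⊆ W) : ∃ j : Fin (L S), ∀ x ∈ S, ξ S j x = f x := by
  obtain ⟨hc, -, hmono, hcells⟩ := hst
  have hSne : S.Nonempty := by
    by_contra h
    rw [not_nonempty_iff_eq_empty] at h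
    exact hℬ.1 (h ▸ hS)
  obtain ⟨x₀, hx₀⟩ := hSne
  have hz₀ : (Fin.snoc x₀ (f x₀) : Fin (m + 1) → ℝ) ∈ ⋃₀ (𝒞 : Set (Set (Fin (m + 1) → ℝ))) := by
    rw [← hΓ]; simpa using hSW hx₀
  obtain ⟨T, hT𝒞, hzT⟩ := mem_sUnion.1 hz₀
  have hT : T ∈ 𝒯 := h𝒞 hT𝒞
  obtain ⟨S', hS', hT'⟩ := (hcells T).1 hT
  -- `S' = S` since both contain `x₀`
  have hx₀S' : x₀ ∈ S' := by
    rcases hT' with ⟨j, rfl⟩ | ⟨j, rfl⟩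
    · simpa using (show (Fin.snoc x₀ (f x₀) : Fin (m + 1) → ℝ) ∈ graphOver S' (ξ S' j) from hzT).1
    · exact (snoc_mem_bandOver_iff.1 hzT).1
  have hSS' : S' = S := by
    obtain ⟨B, hB, huniq⟩ := hℬ.2 x₀
    rw [huniq S' ⟨hS', hx₀S'⟩, huniq S ⟨hS, hx₀⟩]
  subst hSS'
  have hTsub : T ⊆ graphOver W f := by rw [hΓ]; exact subset_sUnion_of_mem hT𝒞
  rcases hT' with ⟨j, rfl⟩ | ⟨j, rfl⟩
  · refine ⟨j, fun x hx => ?_⟩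
    have h : (Fin.snoc x (ξ S' j x) : Fin (m + 1) → ℝ) ∈ graphOver W f := hTsub (by simp [hx])
    rw [snoc_mem_graphOver_iff] at h
    exact h.2
  · exfalso
    refine not_band_subset_graphlike hzT (Γ := graphOver W f) (fun t t' ht ht' => ?_) hTsub
    rw [snoc_mem_graphOver_iff] at ht ht'
    rw [ht.2, ht'.2]

/-- **A covered cell lies in one member of the cover** when the members are unions of cells.
[cite: Dries1998, Ch. 3 (2.11)] -/
theorem exists_cell_subset_V (hpart : Setoid.IsPartition (𝒯 : Set (Set (Fin (m + 1) → ℝ)))) {q : ℕ}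
    {V : Fin q → Set (Fin (m + 1) → ℝ)} {𝒞 : Fin q → Finset (Set (Fin (m + 1) → ℝ))}
    (h𝒞 : ∀ j, 𝒞 j ⊆ 𝒯) (hV : ∀ j, V j = ⋃₀ ((𝒞 j : Finset _) : Set (Set (Fin (m + 1) → ℝ))))
    {T : Set (Fin (m + 1) → ℝ)} (hT : T ∈ 𝒯) {z : Fin (m + 1) → ℝ} (hz : z ∈ T) {j : Fin q} (hzV : z ∈ V j) :
    T ⊆ V j := by
  rcases subset_or_disjoint_sUnion hpart (h𝒞 j) hT with h | h
  · rw [hV j]; exact h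
  · exfalso
    rw [hV j] at hzV
    exact disjoint_left.1 h hz hzV

end CADExtract

/-! ### §2 Thin bands: a ladder with closed pieces in single members of the cover -/

section ThinBands

variable {m q : ℕ}

/-- Distance to the complement of `V j` (`1` if empty). [cite: Pawlucki2024, Prop. 2.5] -/
def coverDist (V : Fin q → Set (Fin (m + 1) → ℝ)) (j : Fin q) (z : Fin (m + 1) → ℝ) : ℝ := by
  classical
  exact if ((V j)ᶜ).Nonempty then infDist z (V j)ᶜ else 1

variable {V : Fin q → Set (Fin (m + 1) → ℝ)}

/-- `coverDist > 0` on `V j` (open). [cite: Pawlucki2024, Prop. 2.5] -/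
theorem coverDist_pos (hVo : ∀ j, IsOpen (V j)) {j : Fin q} {z : Fin (m + 1) → ℝ} (hz : z ∈ V j) :
    0 < coverDist V j z := by
  unfold coverDist; split_ifs with h
  · exact (infDist_compl_pos_iff (hVo j) h).2 hz
  · exact one_pos

/-- The disc argument. [cite: Pawlucki2024, Prop. 2.5] -/
theorem mem_V_of_dist_lt_coverDist {j : Fin q} {z w : Fin (m + 1) → ℝ} (h : dist z w < coverDist V j z) : w ∈ V j := by
  unfold coverDist at h
  split_ifs at h with hne
  · exact mem_of_dist_lt_infDist_compl h
  · rw [not_nonempty_iff_eq_empty, compl_empty_iff] at hne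
    rw [hne]; exact mem_univ _

/-- `coverDist` is continuous. [cite: Pawlucki2024, Prop. 2.5] -/
theorem continuous_coverDist (j : Fin q) : Continuous (coverDist V j) := by
  unfold coverDist; split_ifs
  · exact continuous_infDist_pt _
  · exact continuous_const

/-- `coverDist` is semialgebraic. [cite: BochnakCosteRoy1998, Prop. 2.2.8] -/
theorem coverDist_sa (hVs : ∀ j, IsSemialgebraic ℝ (V j)) (j : Fin q) : IsSemialgebraicFunOn ℝ univ (coverDist V j) := by
  unfold coverDist; split_ifs
  · exact isSemialgebraicFunOn_infDist (hVs j).compl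
  · exact isSemialgebraicFunOn_const' isSemialgebraic_univ 1

/-- A third of the gaps around the `i`-th section (`1` where there is no neighbour). [cite: Pawlucki2024, p. 3872] -/
def tlGap (φ : ℕ → (Fin m → ℝ) → ℝ) (p i : ℕ) (x : Fin m → ℝ) : ℝ :=
  min (if i = 0 then 1 else (φ i x - φ (i - 1) x) / 3) (if i < p then (φ (i + 1) x - φ i x) / 3 else 1)

/-- The thickness `τ_i = min (gaps/3, coverDist/2)` of the thin band around the `i`-th section.
[cite: Pawlucki2024, p. 3872] -/
def tlTau (V : Fin q → Set (Fin (m + 1) → ℝ)) (φ : ℕ → (Fin m → ℝ) → ℝ) (p : ℕ) (g : ℕ → Fin q) (i : ℕ)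
    (x : Fin m → ℝ) : ℝ :=
  min (tlGap φ p i x) (coverDist V (g i) (Fin.snoc x (φ i x)) / 2)

/-- **The thin-band ladder**: `φ₀, φ₀+τ₀, φ₁-τ₁, φ₁+τ₁, …, φ_p-τ_p, φ_p`. [cite: Pawlucki2024, p. 3872] -/
def tlPsi (V : Fin q → Set (Fin (m + 1) → ℝ)) (φ : ℕ → (Fin m → ℝ) → ℝ) (p : ℕ) (g : ℕ → Fin q) (ν : ℕ)
    (x : Fin m → ℝ) : ℝ :=
  if ν % 2 = 0 then
    (if ν / 2 = 0 then φ 0 x else if ν / 2 ≤ p then φ (ν / 2) x - tlTau V φ p g (ν / 2) x else φ p x)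
  else (if ν / 2 < p then φ (ν / 2) x + tlTau V φ p g (ν / 2) x else φ p x)

/-- Cover indices of the ladder pieces: even pieces around graphs, odd pieces inside bands.
[cite: Pawlucki2024, p. 3872] -/
def tlJb (g bnd : ℕ → Fin q) (ν : ℕ) : Fin q := if ν % 2 = 0 then g (ν / 2) else bnd (ν / 2)

variable {φ : ℕ → (Fin m → ℝ) → ℝ} {p : ℕ} {g bnd : ℕ → Fin q} {S : Set (Fin m → ℝ)}

/-- `τ_i > 0`. [cite: Pawlucki2024, p. 3872] -/
theorem tlTau_pos (hVo : ∀ j, IsOpen (V j)) (hlt : ∀ x ∈ S, ∀ i < p, φ i x < φ (i + 1) x)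
    (hg : ∀ i ≤ p, ∀ x ∈ S, (Fin.snoc x (φ i x) : Fin (m + 1) → ℝ) ∈ V (g i)) {i : ℕ} (hi : i ≤ p)
    {x : Fin m → ℝ} (hx : x ∈ S) : 0 < tlTau V φ p g i x := by
  unfold tlTau tlGap
  refine lt_min (lt_min ?_ ?_) (half_pos (coverDist_pos hVo (hg i hi x hx)))
  · split_ifs with h0
    · exact one_pos
    · have h := hlt x hx (i - 1) (by omega)
      have : i - 1 + 1 = i := by omega
      rw [this] at h
      linarith
  · split_ifs with hp
    · have h := hlt x hx i hp; linarith
    · exact one_pos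

/-- `τ_i ≤ (φ_{i+1} - φ_i)/3`. [cite: Pawlucki2024, p. 3872] -/
theorem tlTau_le_gap_up {i : ℕ} (hi : i < p) (x : Fin m → ℝ) : tlTau V φ p g i x ≤ (φ (i + 1) x - φ i x) / 3 := by
  unfold tlTau tlGap
  refine (min_le_left _ _).trans ((min_le_right _ _).trans ?_)
  rw [if_pos hi]

/-- `τ_i ≤ (φ_i - φ_{i-1})/3`. [cite: Pawlucki2024, p. 3872] -/
theorem tlTau_le_gap_down {i : ℕ} (hi : i ≠ 0) (x : Fin m → ℝ) : tlTau V φ p g i x ≤ (φ i x - φ (i - 1) x) / 3 := by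
  unfold tlTau tlGap
  refine (min_le_left _ _).trans ((min_le_left _ _).trans ?_)
  rw [if_neg hi]

/-- `τ_i < coverDist` at the graph point. [cite: Pawlucki2024, p. 3872] -/
theorem tlTau_lt_coverDist (hVo : ∀ j, IsOpen (V j))
    (hg : ∀ i ≤ p, ∀ x ∈ S, (Fin.snoc x (φ i x) : Fin (m + 1) → ℝ) ∈ V (g i)) {i : ℕ} (hi : i ≤ p)
    {x : Fin m → ℝ} (hx : x ∈ S) : tlTau V φ p g i x < coverDist V (g i) (Fin.snoc x (φ i x)) := by
  unfold tlTau
  have h := coverDist_pos hVo (hg i hi x hx)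
  exact (min_le_right _ _).trans_lt (by linarith)

/-- Points vertically within `τ_i` of the `i`-th graph point lie in `V (g i)`. [cite: Pawlucki2024, p. 3872] -/
theorem snoc_mem_V_of_abs_le (hVo : ∀ j, IsOpen (V j))
    (hg : ∀ i ≤ p, ∀ x ∈ S, (Fin.snoc x (φ i x) : Fin (m + 1) → ℝ) ∈ V (g i)) {i : ℕ} (hi : i ≤ p)
    {x : Fin m → ℝ} (hx : x ∈ S) {t : ℝ} (ht : |t - φ i x| ≤ tlTau V φ p g i x) :
    (Fin.snoc x t : Fin (m + 1) → ℝ) ∈ V (g i) := by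
  refine mem_V_of_dist_lt_coverDist (z := Fin.snoc x (φ i x)) ?_
  rw [LadderData.dist_snoc_snoc, dist_self, max_eq_right dist_nonneg, Real.dist_eq, abs_sub_comm]
  exact ht.trans_lt (tlTau_lt_coverDist hVo hg hi hx)

/-- Unfolding `tlPsi` at even indices `2i`. [cite: Pawlucki2024, p. 3872] -/
theorem tlPsi_even (i : ℕ) (x : Fin m → ℝ) :
    tlPsi V φ p g (2 * i) x = (if i = 0 then φ 0 x else if i ≤ p then φ i x - tlTau V φ p g i x else φ p x) := by
  unfold tlPsi
  have h1 : 2 * i % 2 = 0 := by omega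
  have h2 : 2 * i / 2 = i := by omega
  rw [if_pos h1, h2]

/-- Unfolding `tlPsi` at odd indices `2i+1`. [cite: Pawlucki2024, p. 3872] -/
theorem tlPsi_odd (i : ℕ) (x : Fin m → ℝ) :
    tlPsi V φ p g (2 * i + 1) x = (if i < p then φ i x + tlTau V φ p g i x else φ p x) := by
  unfold tlPsi
  have h1 : (2 * i + 1) % 2 ≠ 0 := by omega
  have h2 : (2 * i + 1) / 2 = i := by omega
  rw [if_neg h1, h2]

/-- `ψ₀ = φ₀`. [cite: Pawlucki2024, p. 3872] -/
theorem tlPsi_zero (x : Fin m → ℝ) : tlPsi V φ p g 0 x = φ 0 x := by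
  have h := tlPsi_even (V := V) (φ := φ) (p := p) (g := g) 0 x
  rw [mul_zero] at h; rw [h, if_pos rfl]

/-- `ψ_ν = φ_p` for `ν ≥ 2p+1`. [cite: Pawlucki2024, p. 3872] -/
theorem tlPsi_top {ν : ℕ} (hν : 2 * p + 1 ≤ ν) (x : Fin m → ℝ) : tlPsi V φ p g ν x = φ p x := by
  rcases Nat.even_or_odd ν with ⟨i, hi⟩ | ⟨i, hi⟩
  · rw [show ν = 2 * i by omega, tlPsi_even]
    rw [if_neg (by omega), if_neg (by omega)]
  · rw [hi, tlPsi_odd, if_neg (by omega)]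

/-- **The ladder is strictly increasing below `2p+1`.** [cite: Pawlucki2024, p. 3872] -/
theorem tlPsi_lt (hVo : ∀ j, IsOpen (V j)) (hp : 0 < p) (hlt : ∀ x ∈ S, ∀ i < p, φ i x < φ (i + 1) x)
    (hg : ∀ i ≤ p, ∀ x ∈ S, (Fin.snoc x (φ i x) : Fin (m + 1) → ℝ) ∈ V (g i)) {x : Fin m → ℝ} (hx : x ∈ S)
    {ν : ℕ} (hν : ν < 2 * p + 1) : tlPsi V φ p g ν x < tlPsi V φ p g (ν + 1) x := by
  rcases Nat.even_or_odd ν with ⟨i, hi⟩ | ⟨i, hi⟩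
  · have hν' : ν = 2 * i := by omega
    rw [hν', tlPsi_even, tlPsi_odd]
    have hip : i ≤ p := by omega
    by_cases hi0 : i = 0
    · subst hi0
      rw [if_pos rfl, if_pos hp]
      linarith [tlTau_pos hVo hlt hg (Nat.zero_le p) hx (i := 0)]
    · rw [if_neg hi0, if_pos hip]
      by_cases hip' : i < p
      · rw [if_pos hip']; linarith [tlTau_pos hVo hlt hg hip hx]
      · have : i = p := by omega
        subst this
        rw [if_neg (lt_irrefl _)]; linarith [tlTau_pos hVo hlt hg le_rfl hx (i := i)]
  · rw [hi, tlPsi_odd, show 2 * i + 1 + 1 = 2 * (i + 1) by ring, tlPsi_even]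
    have hip : i < p := by omega
    rw [if_pos hip, if_neg (by omega), if_pos (by omega)]
    have h1 := tlTau_le_gap_up (V := V) (φ := φ) (g := g) hip x
    have h2 := tlTau_le_gap_down (V := V) (φ := φ) (p := p) (g := g) (i := i + 1) (by omega) x
    rw [Nat.add_sub_cancel] at h2
    have h3 := hlt x hx i hip
    linarith

/-- **Every closed piece of the ladder lies in a single member of the cover.** [cite: Pawlucki2024, p. 3872] -/
theorem tlPsi_piece (hVo : ∀ j, IsOpen (V j)) (hp : 0 < p) (hlt : ∀ x ∈ S, ∀ i < p, φ i x < φ (i + 1) x)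
    (hg : ∀ i ≤ p, ∀ x ∈ S, (Fin.snoc x (φ i x) : Fin (m + 1) → ℝ) ∈ V (g i))
    (hbnd : ∀ i < p, ∀ x ∈ S, ∀ t ∈ Ioo (φ i x) (φ (i + 1) x), (Fin.snoc x t : Fin (m + 1) → ℝ) ∈ V (bnd i))
    {ν : ℕ} (hν : ν < 2 * p + 1) {x : Fin m → ℝ} (hx : x ∈ S) {t : ℝ}
    (ht : t ∈ Icc (tlPsi V φ p g ν x) (tlPsi V φ p g (ν + 1) x)) :
    (Fin.snoc x t : Fin (m + 1) → ℝ) ∈ V (tlJb g bnd ν) := by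
  rcases Nat.even_or_odd ν with ⟨i, hi⟩ | ⟨i, hi⟩
  · have hν' : ν = 2 * i := by omega
    have hjb : tlJb g bnd ν = g i := by unfold tlJb; rw [if_pos (by omega)]; congr 1; omega
    rw [hjb]
    rw [hν', tlPsi_even, tlPsi_odd] at ht
    have hip : i ≤ p := by omega
    refine snoc_mem_V_of_abs_le hVo hg hip hx ?_
    have hτ := (tlTau_pos hVo hlt hg hip hx).le
    by_cases hi0 : i = 0
    · subst hi0
      rw [if_pos rfl, if_pos hp] at ht
      rw [abs_le]; constructor <;> linarith [ht.1, ht.2]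
    · rw [if_neg hi0, if_pos hip] at ht
      by_cases hip' : i < p
      · rw [if_pos hip'] at ht
        rw [abs_le]; constructor <;> linarith [ht.1, ht.2]
      · have : i = p := by omega
        subst this
        rw [if_neg (lt_irrefl _)] at ht
        rw [abs_le]; constructor <;> linarith [ht.1, ht.2]
  · have hjb : tlJb g bnd ν = bnd i := by unfold tlJb; rw [if_neg (by omega)]; congr 1; omega
    rw [hjb]
    rw [hi, tlPsi_odd, show 2 * i + 1 + 1 = 2 * (i + 1) by ring, tlPsi_even] at ht
    have hip : i < p := by omega
    rw [if_pos hip, if_neg (by omega), if_pos (by omega)] at ht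
    refine hbnd i hip x hx t ⟨?_, ?_⟩
    · linarith [ht.1, tlTau_pos hVo hlt hg hip.le hx]
    · have h := tlTau_pos hVo hlt hg (show i + 1 ≤ p by omega) hx
      linarith [ht.2]

/-- `tlGap i` is continuous on `S`. [cite: Pawlucki2024, p. 3872] -/
theorem continuousOn_tlGap (hφc : ∀ i ≤ p, ContinuousOn (φ i) S) {i : ℕ} (hi : i ≤ p) : ContinuousOn (tlGap φ p i) S := by
  unfold tlGap
  refine continuousOn_min₂ ?_ ?_
  · split_ifs with h0
    · exact continuousOn_const
    · exact ((hφc i hi).sub (hφc (i - 1) (by omega))).div_const _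
  · split_ifs with hp
    · exact ((hφc (i + 1) hp).sub (hφc i hi)).div_const _
    · exact continuousOn_const

/-- `τ_i` is continuous on `S`. [cite: Pawlucki2024, p. 3872] -/
theorem continuousOn_tlTau (hφc : ∀ i ≤ p, ContinuousOn (φ i) S) {i : ℕ} (hi : i ≤ p) : ContinuousOn (tlTau V φ p g i) S := by
  unfold tlTau
  refine continuousOn_min₂ (continuousOn_tlGap hφc hi) ?_
  exact ((continuous_coverDist (g i)).comp_continuousOn
    (continuous_snoc_prod'.comp_continuousOn (continuousOn_id.prodMk (hφc i hi)))).div_const _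

/-- **The ladder functions are continuous on `S`.** [cite: Pawlucki2024, p. 3872] -/
theorem continuousOn_tlPsi (hφc : ∀ i ≤ p, ContinuousOn (φ i) S) (ν : ℕ) : ContinuousOn (tlPsi V φ p g ν) S := by
  rcases Nat.even_or_odd ν with ⟨i, hi⟩ | ⟨i, hi⟩
  · have hν' : ν = 2 * i := by omega
    have h : ∀ x, tlPsi V φ p g ν x = (if i = 0 then φ 0 x else if i ≤ p then φ i x - tlTau V φ p g i x else φ p x) :=
      fun x => by rw [hν', tlPsi_even]
    refine ContinuousOn.congr ?_ (fun x _ => h x)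
    split_ifs with h0 hip
    · exact hφc 0 (Nat.zero_le _)
    · exact (hφc i hip).sub (continuousOn_tlTau hφc hip)
    · exact hφc p le_rfl
  · have h : ∀ x, tlPsi V φ p g ν x = (if i < p then φ i x + tlTau V φ p g i x else φ p x) :=
      fun x => by rw [hi, tlPsi_odd]
    refine ContinuousOn.congr ?_ (fun x _ => h x)
    split_ifs with hip
    · exact (hφc i hip.le).add (continuousOn_tlTau hφc hip.le)
    · exact hφc p le_rfl

/-- `tlGap i` is semialgebraic on `S`. [cite: Pawlucki2024, p. 3872] -/
theorem tlGap_sa (hS : IsSemialgebraic ℝ S) (hφs : ∀ i ≤ p, IsSemialgebraicFunOn ℝ S (φ i)) {i : ℕ} (hi : i ≤ p) :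
    IsSemialgebraicFunOn ℝ S (tlGap φ p i) := by
  unfold tlGap
  refine IsSemialgebraicFunOn.min hS ?_ ?_
  · split_ifs with h0
    · exact isSemialgebraicFunOn_const' hS 1
    · exact IsSemialgebraicFunOn.div₀ hS (IsSemialgebraicFunOn.sub_holds (hφs i hi) (hφs (i - 1) (by omega)))
        (isSemialgebraicFunOn_const' hS 3)
  · split_ifs with hp
    · exact IsSemialgebraicFunOn.div₀ hS (IsSemialgebraicFunOn.sub_holds (hφs (i + 1) hp) (hφs i hi))
        (isSemialgebraicFunOn_const' hS 3)
    · exact isSemialgebraicFunOn_const' hS 1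

/-- `τ_i` is semialgebraic on `S`. [cite: Pawlucki2024, p. 3872] -/
theorem tlTau_sa (hVs : ∀ j, IsSemialgebraic ℝ (V j)) (hS : IsSemialgebraic ℝ S)
    (hφs : ∀ i ≤ p, IsSemialgebraicFunOn ℝ S (φ i)) {i : ℕ} (hi : i ≤ p) :
    IsSemialgebraicFunOn ℝ S (tlTau V φ p g i) := by
  unfold tlTau
  refine IsSemialgebraicFunOn.min hS (tlGap_sa hS hφs hi) ?_
  have hmap := isSemialgebraicMapOn_snoc hS (hφs i hi)
  have h := IsSemialgebraicFunOn.comp_isSemialgebraicMapOn_holds (coverDist_sa hVs (g i)) hmap fun x _ => mem_univ _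
  exact IsSemialgebraicFunOn.div₀ hS h (isSemialgebraicFunOn_const' hS 2)

/-- **The ladder functions are semialgebraic on `S`.** [cite: Pawlucki2024, p. 3872] -/
theorem tlPsi_sa (hVs : ∀ j, IsSemialgebraic ℝ (V j)) (hS : IsSemialgebraic ℝ S)
    (hφs : ∀ i ≤ p, IsSemialgebraicFunOn ℝ S (φ i)) (ν : ℕ) : IsSemialgebraicFunOn ℝ S (tlPsi V φ p g ν) := by
  rcases Nat.even_or_odd ν with ⟨i, hi⟩ | ⟨i, hi⟩
  · have hν' : ν = 2 * i := by omega
    have h : ∀ x, tlPsi V φ p g ν x = (if i = 0 then φ 0 x else if i ≤ p then φ i x - tlTau V φ p g i x else φ p x) :=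
      fun x => by rw [hν', tlPsi_even]
    refine IsSemialgebraicFunOn.congr ?_ (fun x _ => (h x).symm)
    split_ifs with h0 hip
    · exact hφs 0 (Nat.zero_le _)
    · exact IsSemialgebraicFunOn.sub_holds (hφs i hip) (tlTau_sa hVs hS hφs hip)
    · exact hφs p le_rfl
  · have h : ∀ x, tlPsi V φ p g ν x = (if i < p then φ i x + tlTau V φ p g i x else φ p x) :=
      fun x => by rw [hi, tlPsi_odd]
    refine IsSemialgebraicFunOn.congr ?_ (fun x _ => (h x).symm)
    split_ifs with hip
    · exact IsSemialgebraicFunOn.add_holds (hφs i hip.le) (tlTau_sa hVs hS hφs hip.le)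
    · exact hφs p le_rfl

end ThinBands

/-! ### §3 Free windows and the per-cell construction -/

section FreeWindow

variable {m q : ℕ}

/-- A **free window**: the cover, the window `[γ, δ]` and its free base `Fr`.
[cite: Pawlucki2024, Prop. 2.5 (proof, Part II), the capsules `L'`] -/
structure FreeWindow (m q : ℕ) where
  /-- the cover -/
  V : Fin q → Set (Fin (m + 1) → ℝ)
  /-- bottom of the window -/
  γ : (Fin m → ℝ) → ℝ
  /-- top of the window -/
  δ : (Fin m → ℝ) → ℝ
  /-- the free base -/
  Fr : Set (Fin m → ℝ)

/-- Hypotheses of a free window. [cite: Pawlucki2024, Prop. 2.5 (proof, Part II)] -/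
structure FreeWindow.Hyp (W : FreeWindow m q) : Prop where
  isOpen_V : ∀ j, IsOpen (W.V j)
  V_sa : ∀ j, IsSemialgebraic ℝ (W.V j)
  γ_cont : Continuous W.γ
  δ_cont : Continuous W.δ
  γ_sa : IsSemialgebraicFunOn ℝ univ W.γ
  δ_sa : IsSemialgebraicFunOn ℝ univ W.δ
  Fr_sa : IsSemialgebraic ℝ W.Fr
  Fr_bdd : Bornology.IsBounded W.Fr
  γ_lt_δ : ∀ x ∈ W.Fr, W.γ x < W.δ x
  pinch : ∀ z ∈ closure W.Fr, z ∉ W.Fr → W.γ z = W.δ z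
  cover : ∀ x ∈ W.Fr, ∀ t ∈ Icc (W.γ x) (W.δ x), ∃ j, (Fin.snoc x t : Fin (m + 1) → ℝ) ∈ W.V j

/-- The conclusion shape: a finite family of continuous semialgebraic cuts and an open semialgebraic
set `U ⊇ A` on which (inside `Fr`) the family is valid. [cite: Pawlucki2024, Prop. 2.5 (proof, Part II)] -/
def FreeWindow.Serves (W : FreeWindow m q) (A : Set (Fin m → ℝ)) (𝒞 : Finset ((Fin m → ℝ) → ℝ))
    (U : Set (Fin m → ℝ)) : Prop :=
  (∀ c ∈ 𝒞, Continuous c ∧ IsSemialgebraicFunOn ℝ univ c) ∧ IsOpen U ∧ IsSemialgebraic ℝ U ∧ A ⊆ U ∧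
    ∀ x ∈ U ∩ W.Fr, RCValid W.γ W.δ W.V 𝒞 x

namespace FreeWindow

variable {W : FreeWindow m q} (H : W.Hyp)
include H

omit H in
/-- Monotonicity of `Serves` in the family and antitonicity in the served set. [cite: Pawlucki2024, Prop. 2.5] -/
theorem Serves.mono {A A' : Set (Fin m → ℝ)} {𝒞 𝒞' : Finset ((Fin m → ℝ) → ℝ)} {U : Set (Fin m → ℝ)}
    (h : W.Serves A 𝒞 U) (hA : A' ⊆ A) (h𝒞 : 𝒞 ⊆ 𝒞') (h𝒞' : ∀ c ∈ 𝒞', Continuous c ∧ IsSemialgebraicFunOn ℝ univ c) :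
    W.Serves A' 𝒞' U :=
  ⟨h𝒞', h.2.1, h.2.2.1, hA.trans h.2.2.2.1, fun x hx => (h.2.2.2.2 x hx).mono h𝒞⟩

omit H in
open Classical in
/-- Union of two served sets. [cite: Pawlucki2024, Prop. 2.5] -/
theorem Serves.union {A A' : Set (Fin m → ℝ)} {𝒞 𝒞' : Finset ((Fin m → ℝ) → ℝ)} {U U' : Set (Fin m → ℝ)}
    (h : W.Serves A 𝒞 U) (h' : W.Serves A' 𝒞' U') : W.Serves (A ∪ A') (𝒞 ∪ 𝒞') (U ∪ U') := by
  classical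
  refine ⟨fun c hc => ?_, h.2.1.union h'.2.1, h.2.2.1.union h'.2.2.1, union_subset_union h.2.2.2.1 h'.2.2.2.1,
    fun x hx => ?_⟩
  · rcases Finset.mem_union.1 hc with hc | hc
    · exact h.1 c hc
    · exact h'.1 c hc
  · rcases hx.1 with hxU | hxU
    · exact (h.2.2.2.2 x ⟨hxU, hx.2⟩).mono Finset.subset_union_left
    · exact (h'.2.2.2.2 x ⟨hxU, hx.2⟩).mono Finset.subset_union_right

omit H in
/-- The empty set is served by nothing. [cite: Pawlucki2024, Prop. 2.5] -/
theorem Serves.empty : W.Serves ∅ ∅ ∅ :=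
  ⟨fun _ h => absurd h (Finset.notMem_empty _), isOpen_empty, isSemialgebraic_empty, empty_subset _,
    fun _ hx => absurd hx.1 (notMem_empty _)⟩

/-! #### The per-cell construction -/

variable {𝒯 : Finset (Set (Fin (m + 1) → ℝ))} {ℬ : Finset (Set (Fin m → ℝ))}
  {L : Set (Fin m → ℝ) → ℕ} {ξ : (S : Set (Fin m → ℝ)) → Fin (L S) → (Fin m → ℝ) → ℝ}

/-- **Cuts near a cell** [Pawlucki2024, p. 3872, over one `B_ν`]: for a base cell `S ⊆ Fr` of a
decomposition adapted to the cover and to the graphs of `γ, δ`, and a semialgebraic `K ⊆ S` away from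
the nondegenerate frontier of `S`, finitely many cuts serve a neighbourhood of `K`.
[cite: Pawlucki2024, Prop. 2.5 (proof, Part II)] -/
theorem exists_serves_near_cell (hpart : Setoid.IsPartition (𝒯 : Set (Set (Fin (m + 1) → ℝ))))
    (hℬ : IsCylindricalDecomposition ℝ m ℬ) (hst : IsStackOf ℬ 𝒯 L ξ)
    {𝒞V : Fin q → Finset (Set (Fin (m + 1) → ℝ))} (h𝒞V : ∀ j, 𝒞V j ⊆ 𝒯)
    (hV : ∀ j, W.V j = ⋃₀ ((𝒞V j : Finset _) : Set (Set (Fin (m + 1) → ℝ))))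
    {𝒞γ 𝒞δ : Finset (Set (Fin (m + 1) → ℝ))} (h𝒞γ : 𝒞γ ⊆ 𝒯) (h𝒞δ : 𝒞δ ⊆ 𝒯)
    (hΓγ : graphOver W.Fr W.γ = ⋃₀ (𝒞γ : Set (Set (Fin (m + 1) → ℝ))))
    (hΓδ : graphOver W.Fr W.δ = ⋃₀ (𝒞δ : Set (Set (Fin (m + 1) → ℝ))))
    {S : Set (Fin m → ℝ)} (hS : S ∈ ℬ) (hSFr : S ⊆ W.Fr)
    {K : Set (Fin m → ℝ)} (hKS : K ⊆ S) (hKsa : IsSemialgebraic ℝ K)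
    (hKsep : ∀ z ∈ closure K, z ∈ closure S → z ∉ S → z ∉ W.Fr) :
    ∃ 𝒞 U, W.Serves K 𝒞 U := by
  classical
  rcases K.eq_empty_or_nonempty with rfl | hKne
  · exact ⟨∅, ∅, Serves.empty⟩
  obtain ⟨hc, hs, hmono, hcells⟩ := hst
  have hℬpart := hℬ.isPartition
  have hSsa : IsSemialgebraic ℝ S := hℬ.isSemialgebraic S hS
  -- the sections `γ = ξ jγ`, `δ = ξ jδ` over `S`
  obtain ⟨jγ, hjγ⟩ := exists_section_eq hℬpart ⟨hc, hs, hmono, hcells⟩ h𝒞γ hΓγ hS hSFr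
  obtain ⟨jδ, hjδ⟩ := exists_section_eq hℬpart ⟨hc, hs, hmono, hcells⟩ h𝒞δ hΓδ hS hSFr
  obtain ⟨x₀, hx₀⟩ := hKne
  have hx₀S := hKS hx₀
  have hjlt : jγ < jδ := by
    by_contra hle
    have h := (hmono S hS x₀ hx₀S).monotone (not_lt.1 hle)
    rw [hjγ x₀ hx₀S, hjδ x₀ hx₀S] at h
    exact absurd (H.γ_lt_δ x₀ (hSFr hx₀S)) (not_lt.2 h)
  -- a default cover index
  obtain ⟨j₀, -⟩ := H.cover x₀ (hSFr hx₀S) (W.γ x₀) ⟨le_rfl, (H.γ_lt_δ x₀ (hSFr hx₀S)).le⟩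
  -- the sections as an `ℕ`-indexed family
  set p : ℕ := (jδ : ℕ) - jγ with hp
  have hp_pos : 0 < p := by rw [hp]; exact Nat.sub_pos_of_lt hjlt
  have hidx : ∀ i ≤ p, (jγ : ℕ) + i < L S := fun i hi => by
    have := jδ.2; omega
  set φ : ℕ → (Fin m → ℝ) → ℝ := fun i x => if h : (jγ : ℕ) + i < L S then ξ S ⟨jγ + i, h⟩ x else W.δ x with hφ
  have hφ_eq : ∀ i (hi : i ≤ p) x, φ i x = ξ S ⟨jγ + i, hidx i hi⟩ x := fun i hi x => by
    simp only [hφ, dif_pos (hidx i hi)]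
  have hφ0 : ∀ x ∈ S, φ 0 x = W.γ x := fun x hx => by
    rw [hφ_eq 0 (Nat.zero_le _)]; simpa using hjγ x hx
  have hφp : ∀ x ∈ S, φ p x = W.δ x := fun x hx => by
    rw [hφ_eq p le_rfl]
    have : (⟨(jγ : ℕ) + p, hidx p le_rfl⟩ : Fin (L S)) = jδ := by ext; simp [hp]; omega
    rw [this]; exact hjδ x hx
  have hφc : ∀ i ≤ p, ContinuousOn (φ i) S := fun i hi =>
    (hc S hS _).congr fun x _ => hφ_eq i hi x
  have hφs : ∀ i ≤ p, IsSemialgebraicFunOn ℝ S (φ i) := fun i hi =>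
    (hs S hS _).congr fun x _ => (hφ_eq i hi x).symm
  have hφlt : ∀ x ∈ S, ∀ i < p, φ i x < φ (i + 1) x := fun x hx i hi => by
    rw [hφ_eq i hi.le, hφ_eq (i + 1) hi]
    exact hmono S hS x hx (Fin.mk_lt_mk.2 (by omega))
  have hφmono : ∀ x ∈ S, ∀ i j, i ≤ j → j ≤ p → φ i x ≤ φ j x := fun x hx i j hij hj => by
    rw [hφ_eq i (hij.trans hj), hφ_eq j hj]
    exact (hmono S hS x hx).monotone (Fin.mk_le_mk.2 (by omega))
  have hφwin : ∀ i ≤ p, ∀ x ∈ S, φ i x ∈ Icc (W.γ x) (W.δ x) := fun i hi x hx =>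
    ⟨by rw [← hφ0 x hx]; exact hφmono x hx 0 i (Nat.zero_le _) hi,
     by rw [← hφp x hx]; exact hφmono x hx i p hi le_rfl⟩
  -- graphs inside single members of the cover
  have hgraph : ∀ i ≤ p, ∃ j, ∀ x ∈ S, (Fin.snoc x (φ i x) : Fin (m + 1) → ℝ) ∈ W.V j := by
    intro i hi
    obtain ⟨j, hj⟩ := H.cover x₀ (hSFr hx₀S) (φ i x₀) (hφwin i hi x₀ hx₀S)
    have hT : graphOver S (ξ S ⟨jγ + i, hidx i hi⟩) ∈ 𝒯 := (hcells _).2 ⟨S, hS, Or.inl ⟨_, rfl⟩⟩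
    have hz : (Fin.snoc x₀ (φ i x₀) : Fin (m + 1) → ℝ) ∈ graphOver S (ξ S ⟨jγ + i, hidx i hi⟩) := by
      rw [snoc_mem_graphOver_iff]; exact ⟨hx₀S, hφ_eq i hi x₀⟩
    have hsub := exists_cell_subset_V hpart h𝒞V hV hT hz hj
    refine ⟨j, fun x hx => hsub ?_⟩
    rw [snoc_mem_graphOver_iff]; exact ⟨hx, hφ_eq i hi x⟩
  -- bands inside single members of the cover
  have hband : ∀ i < p, ∃ j, ∀ x ∈ S, ∀ t ∈ Ioo (φ i x) (φ (i + 1) x), (Fin.snoc x t : Fin (m + 1) → ℝ) ∈ W.V j := by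
    intro i hi
    set jb : Fin (L S + 1) := ⟨jγ + i + 1, by have := hidx (i + 1) hi; omega⟩ with hjb
    have hjb0 : jb ≠ 0 := by
      rw [Ne, Fin.ext_iff]; simp [hjb]
    have hjbl : jb ≠ Fin.last (L S) := by
      have := hidx (i + 1) hi
      rw [Ne, Fin.ext_iff]; simp only [hjb, Fin.val_last]; omega
    have hpred : ∀ x, ξ S (jb.pred hjb0) x = φ i x := fun x => by
      rw [hφ_eq i hi.le]; congr 1
    have hcast : ∀ x, ξ S (jb.castPred hjbl) x = φ (i + 1) x := fun x => by
      rw [hφ_eq (i + 1) hi]; congr 1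
    have hT : bandOver S (ξ S) jb ∈ 𝒯 := (hcells _).2 ⟨S, hS, Or.inr ⟨jb, rfl⟩⟩
    have hmemT : ∀ x ∈ S, ∀ t ∈ Ioo (φ i x) (φ (i + 1) x), (Fin.snoc x t : Fin (m + 1) → ℝ) ∈ bandOver S (ξ S) jb := by
      intro x hx t ht
      rw [snoc_mem_bandOver_iff_of_ne hjb0 hjbl, hpred, hcast]
      exact ⟨hx, ht⟩
    -- the midpoint over `x₀` is covered
    set t₀ := (φ i x₀ + φ (i + 1) x₀) / 2 with ht₀
    have hlt₀ := hφlt x₀ hx₀S i hi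
    have ht₀mem : t₀ ∈ Ioo (φ i x₀) (φ (i + 1) x₀) := ⟨by rw [ht₀]; linarith, by rw [ht₀]; linarith⟩
    obtain ⟨j, hj⟩ := H.cover x₀ (hSFr hx₀S) t₀
      ⟨(hφwin i hi.le x₀ hx₀S).1.trans ht₀mem.1.le, ht₀mem.2.le.trans (hφwin (i + 1) hi x₀ hx₀S).2⟩
    have hsub := exists_cell_subset_V hpart h𝒞V hV hT (hmemT x₀ hx₀S t₀ ht₀mem) hj
    exact ⟨j, fun x hx t ht => hsub (hmemT x hx t ht)⟩
  haveI : Nonempty (Fin q) := ⟨j₀⟩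
  choose! gsel hgsel using hgraph
  choose! bsel hbsel using hband
  set g : ℕ → Fin q := fun i => if i ≤ p then gsel i else j₀ with hg
  set bnd : ℕ → Fin q := fun i => if i < p then bsel i else j₀ with hbnd
  have hg' : ∀ i ≤ p, ∀ x ∈ S, (Fin.snoc x (φ i x) : Fin (m + 1) → ℝ) ∈ W.V (g i) := fun i hi x hx => by
    simp only [hg, if_pos hi]; exact hgsel i hi x hx
  have hbnd' : ∀ i < p, ∀ x ∈ S, ∀ t ∈ Ioo (φ i x) (φ (i + 1) x), (Fin.snoc x t : Fin (m + 1) → ℝ) ∈ W.V (bnd i) :=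
    fun i hi x hx t ht => by simp only [hbnd, if_pos hi]; exact hbsel i hi x hx t ht
  -- the chart of the cell `S`
  obtain ⟨d, hcell⟩ := IsCylindricalDecomposition.exists_isSACell (k := ℝ) hℬ S hS
  obtain ⟨ι, U, φc, -, hU, hUeq, hφcc, hφcs, hleft, hright⟩ := hcell.exists_chart
  -- the ladder data
  set Ld : LadderData m d q :=
    { B := S, ι := ι, U := U, φ := φc, V := W.V, jb := tlJb g bnd, γ := W.γ, δ := W.δ,
      ψ := tlPsi W.V φ p g, M := 2 * p + 1, Fr := W.Fr, K := K } with hLd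
  have HL : Ld.Hyp :=
    { B_bdd := H.Fr_bdd.subset hSFr
      isOpen_U := hU.isOpen rfl
      chart_left := hleft
      chart_mem := fun x hx => by show x ∘ ι ∈ U; rw [hUeq]; exact ⟨x, hx, rfl⟩
      chart_right := hright
      φ_cont := hφcc
      isOpen_V := H.isOpen_V
      γ_cont := H.γ_cont
      δ_cont := H.δ_cont
      ψ_cont := fun ν => continuousOn_tlPsi hφc ν
      ψ_zero := fun y hy => by show tlPsi W.V φ p g 0 y = W.γ y; rw [tlPsi_zero, hφ0 y hy]
      ψ_top := fun y hy ν hν => by show tlPsi W.V φ p g ν y = W.δ y; rw [tlPsi_top hν, hφp y hy]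
      ψ_lt := fun y hy ν hν => tlPsi_lt H.isOpen_V hp_pos hφlt hg' hy hν
      M_pos := Nat.succ_pos _
      piece := fun ν hν y hy t ht => tlPsi_piece H.isOpen_V hp_pos hφlt hg' hbnd' hν hy ht
      B_sub := hSFr
      pinch := H.pinch
      K_sub := hKS
      K_sep := hKsep
      K_ne := ⟨x₀, hx₀⟩ }
  have SL : Ld.SA :=
    { chart := ⟨hSsa, hU.isSemialgebraic, hφcs⟩
      V_sa := H.V_sa
      γ_sa := H.γ_sa
      δ_sa := H.δ_sa
      ψ_sa := fun ν => tlPsi_sa H.V_sa hSsa hφs ν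
      Fr_sa := H.Fr_sa
      K_sa := hKsa }
  obtain ⟨c, U', hcc, hcs, hUo, hUs, hKU, hval⟩ := LadderData.exists_thick_cuts HL SL
  refine ⟨Finset.univ.image c, U', fun c' hc' => ?_, hUo, hUs, hKU, fun x hx => hval x hx.1⟩
  obtain ⟨i, -, rfl⟩ := Finset.mem_image.1 hc'
  exact ⟨hcc i, hcs i⟩

/-! #### The induction on the dimension of the served set -/

open Classical in
/-- **The final claim of the proof of Prop. 2.5, by induction on `dim A`** [Pawlucki2024, p. 3872,
"We proceed again by induction on `k`"]: every semialgebraic `A ⊆ Fr` is served.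
[cite: Pawlucki2024, Prop. 2.5 (proof, Part II)] -/
theorem exists_serves : ∀ (d : ℕ) (A : Set (Fin m → ℝ)), A ⊆ W.Fr → IsSemialgebraic ℝ A → sdim A ≤ d →
    ∃ 𝒞 U, W.Serves A 𝒞 U := by
  intro d
  induction d using Nat.strong_induction_on with
  | _ d IH =>
  intro A hAFr hAs hAd
  -- the adapted cylindrical decomposition of `ℝ^{m+1}`
  set cylA : Set (Fin (m + 1) → ℝ) := {z | Fin.init z ∈ A} with hcylA
  set cylFr : Set (Fin (m + 1) → ℝ) := {z | Fin.init z ∈ W.Fr} with hcylFr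
  set 𝓕 : Finset (Set (Fin (m + 1) → ℝ)) :=
    (Finset.univ.image W.V) ∪ {graphOver W.Fr W.γ, graphOver W.Fr W.δ, cylA, cylFr} with h𝓕
  have hΓγsa : IsSemialgebraic ℝ (graphOver W.Fr W.γ) :=
    isSemialgebraicFunOn_iff.mp (H.γ_sa.mono (subset_univ _) H.Fr_sa)
  have hΓδsa : IsSemialgebraic ℝ (graphOver W.Fr W.δ) :=
    isSemialgebraicFunOn_iff.mp (H.δ_sa.mono (subset_univ _) H.Fr_sa)
  have h𝓕sa : ∀ s ∈ 𝓕, IsSemialgebraic ℝ s := by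
    intro s hs
    rcases Finset.mem_union.1 hs with hs | hs
    · obtain ⟨j, -, rfl⟩ := Finset.mem_image.1 hs; exact H.V_sa j
    · simp only [Finset.mem_insert, Finset.mem_singleton] at hs
      rcases hs with rfl | rfl | rfl | rfl
      · exact hΓγsa
      · exact hΓδsa
      · exact hAs.setOf_init_mem
      · exact H.Fr_sa.setOf_init_mem
  obtain ⟨𝒯, h𝒯, hadapt⟩ := IsSemialgebraic.exists_cylindricalDecomposition_holds (k := ℝ) 𝓕 h𝓕sa
  rw [isCylindricalDecomposition_succ] at h𝒯
  obtain ⟨hpart, -, ℬ, hℬ, L, ξ, hc, hs, hmono, hcells⟩ := h𝒯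
  have hst : IsStackOf ℬ 𝒯 L ξ := ⟨hc, hs, hmono, hcells⟩
  have hℬpart := hℬ.isPartition
  -- adaptedness data
  have hmem : ∀ s, s = graphOver W.Fr W.γ ∨ s = graphOver W.Fr W.δ ∨ s = cylA ∨ s = cylFr → s ∈ 𝓕 := by
    intro s hs'
    refine Finset.mem_union_right _ ?_
    simp only [Finset.mem_insert, Finset.mem_singleton]
    tauto
  have hVmem : ∀ j, W.V j ∈ 𝓕 := fun j => Finset.mem_union_left _ (Finset.mem_image.2 ⟨j, Finset.mem_univ _, rfl⟩)
  choose 𝒞V h𝒞V hV using fun j => hadapt (W.V j) (hVmem j)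
  obtain ⟨𝒞γ, h𝒞γ, hΓγ⟩ := hadapt _ (hmem _ (Or.inl rfl))
  obtain ⟨𝒞δ, h𝒞δ, hΓδ⟩ := hadapt _ (hmem _ (Or.inr (Or.inl rfl)))
  obtain ⟨𝒞A, h𝒞A, hcA⟩ := hadapt _ (hmem _ (Or.inr (Or.inr (Or.inl rfl))))
  obtain ⟨𝒞Fr, h𝒞Fr, hcFr⟩ := hadapt _ (hmem _ (Or.inr (Or.inr (Or.inr rfl))))
  have hAcell : ∀ S ∈ ℬ, S ⊆ A ∨ Disjoint S A := fun S hS => base_subset_or_disjoint hpart hst h𝒞A hcA.symm hS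
  -- the top-dimensional cells inside `A` and the rest
  set d₀ := sdim A with hd₀
  set 𝒮 : Finset (Set (Fin m → ℝ)) := ℬ.filter fun S => S ⊆ A ∧ sdim S = d₀ with h𝒮
  set ℛ : Finset (Set (Fin m → ℝ)) := ℬ.filter fun S => S ⊆ A ∧ sdim S ≠ d₀ with hℛ
  have hcellA : ∀ x ∈ A, ∃ S ∈ ℬ, x ∈ S ∧ S ⊆ A := by
    intro x hx
    obtain ⟨S, ⟨hS, hxS⟩, -⟩ := hℬpart.2 x
    rcases hAcell S hS with h | h
    · exact ⟨S, hS, hxS, h⟩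
    · exact absurd hx (disjoint_left.1 h hxS)
  set E : Set (Fin m → ℝ) := (⋃ S ∈ ℛ, S) ∪ ⋃ S ∈ 𝒮, ((closure S \ S) ∩ W.Fr) with hE
  have hEFr : E ⊆ W.Fr := by
    rintro x (hx | hx)
    · obtain ⟨S, hS, hxS⟩ := mem_iUnion₂.1 hx
      exact hAFr ((Finset.mem_filter.1 hS).2.1 hxS)
    · obtain ⟨S, -, hxS⟩ := mem_iUnion₂.1 hx
      exact hxS.2
  have hℬsa : ∀ S ∈ ℬ, IsSemialgebraic ℝ S := fun S hS => hℬ.isSemialgebraic S hS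
  have hEsa : IsSemialgebraic ℝ E :=
    (IsSemialgebraic.biUnion _ _ fun S hS => hℬsa S (Finset.mem_filter.1 hS).1).union
      (IsSemialgebraic.biUnion _ _ fun S hS => ((isSemialgebraic_closure (hℬsa S (Finset.mem_filter.1 hS).1)).diff
        (hℬsa S (Finset.mem_filter.1 hS).1)).inter H.Fr_sa)
  -- dimension of `E`
  have hℛdim : ∀ S ∈ ℛ, sdim S < d₀ := fun S hS => by
    obtain ⟨-, hSA, hne⟩ := Finset.mem_filter.1 hS
    exact lt_of_le_of_ne (sdim_mono hSA) hne
  have hfront : ∀ S ∈ 𝒮, (closure S \ S) ∩ W.Fr = ∅ ∨ sdim ((closure S \ S) ∩ W.Fr) < d₀ := fun S hS => by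
    obtain ⟨hSℬ, -, hSd⟩ := Finset.mem_filter.1 hS
    rcases sdim_closure_diff_lt m (hℬsa S hSℬ) with h | h
    · left; rw [h, empty_inter]
    · right; rw [← hSd]; exact (sdim_mono inter_subset_left).trans_lt h
  -- serving `E` by induction (or trivially when empty)
  have hEserv : ∃ 𝒞 U, W.Serves E 𝒞 U := by
    by_cases hd0 : d₀ = 0
    · -- then `E = ∅`
      have hE0 : E = ∅ := by
        apply eq_empty_of_forall_notMem
        rintro x (hx | hx)
        · obtain ⟨S, hS, -⟩ := mem_iUnion₂.1 hx
          have := hℛdim S hS; omega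
        · obtain ⟨S, hS, hxS⟩ := mem_iUnion₂.1 hx
          rcases hfront S hS with h | h
          · rw [h] at hxS; exact hxS
          · omega
      rw [hE0]; exact ⟨∅, ∅, Serves.empty⟩
    · have hd₀d : d₀ - 1 < d := by omega
      have hEdim : sdim E ≤ d₀ - 1 := by
        rw [hE, sdim_union (IsSemialgebraic.biUnion _ _ fun S hS => hℬsa S (Finset.mem_filter.1 hS).1)
          (IsSemialgebraic.biUnion _ _ fun S hS => ((isSemialgebraic_closure (hℬsa S (Finset.mem_filter.1 hS).1)).diff
            (hℬsa S (Finset.mem_filter.1 hS).1)).inter H.Fr_sa)]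
        refine max_le ?_ ?_
        · exact sdim_biUnion_le _ _ (fun S hS => hℬsa S (Finset.mem_filter.1 hS).1) fun S hS => by
            have := hℛdim S hS; omega
        · refine sdim_biUnion_le _ _ (fun S hS => ((isSemialgebraic_closure (hℬsa S (Finset.mem_filter.1 hS).1)).diff
            (hℬsa S (Finset.mem_filter.1 hS).1)).inter H.Fr_sa) fun S hS => ?_
          rcases hfront S hS with h | h
          · rw [h, sdim_empty]; exact Nat.zero_le _
          · omega
      exact IH (d₀ - 1) hd₀d E hEFr hEsa hEdim
  obtain ⟨𝒞E, UE, hEserves⟩ := hEserv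
  -- serving the top cells away from `U_E`
  have hcellserv : ∀ S ∈ 𝒮, ∃ 𝒞 U, W.Serves (S \ UE) 𝒞 U := by
    intro S hS
    obtain ⟨hSℬ, hSA, -⟩ := Finset.mem_filter.1 hS
    refine exists_serves_near_cell H hpart hℬ hst h𝒞V (fun j => (hV j).symm) h𝒞γ h𝒞δ hΓγ.symm hΓδ.symm hSℬ
      (hSA.trans hAFr) (fun x hx => hx.1) ((hℬsa S hSℬ).diff hEserves.2.2.1) fun z hzK hzcl hzS hzFr => ?_
    -- `z` would be a frontier point of `S` in `Fr`, hence in `E ⊆ U_E`, an open set missing `S ∖ U_E`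
    have hzE : z ∈ E := Or.inr (mem_iUnion₂.2 ⟨S, hS, ⟨hzcl, hzS⟩, hzFr⟩)
    have hzU : UE ∈ 𝓝 z := hEserves.2.1.mem_nhds (hEserves.2.2.2.1 hzE)
    obtain ⟨y, hyU, hyK⟩ := mem_closure_iff_nhds.1 hzK UE hzU
    exact hyK.2 hyU
  choose! 𝒞S US hSserv using hcellserv
  -- assemble
  refine ⟨𝒞E ∪ 𝒮.biUnion 𝒞S, UE ∪ ⋃ S ∈ 𝒮, US S, fun c hc => ?_, ?_, ?_, ?_, fun x hx => ?_⟩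
  · rcases Finset.mem_union.1 hc with hc | hc
    · exact hEserves.1 c hc
    · obtain ⟨S, hS, hcS⟩ := Finset.mem_biUnion.1 hc
      exact (hSserv S hS).1 c hcS
  · exact hEserves.2.1.union (isOpen_biUnion fun S hS => (hSserv S hS).2.1)
  · exact hEserves.2.2.1.union (IsSemialgebraic.biUnion _ _ fun S hS => (hSserv S hS).2.2.1)
  · intro x hxA
    obtain ⟨S, hSℬ, hxS, hSA⟩ := hcellA x hxA
    by_cases hSd : sdim S = d₀
    · have hS : S ∈ 𝒮 := Finset.mem_filter.2 ⟨hSℬ, hSA, hSd⟩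
      by_cases hxU : x ∈ UE
      · exact Or.inl hxU
      · exact Or.inr (mem_iUnion₂.2 ⟨S, hS, (hSserv S hS).2.2.2.1 ⟨hxS, hxU⟩⟩)
    · have hS : S ∈ ℛ := Finset.mem_filter.2 ⟨hSℬ, hSA, hSd⟩
      exact Or.inl (hEserves.2.2.2.1 (Or.inl (mem_iUnion₂.2 ⟨S, hS, hxS⟩)))
  · rcases hx.1 with hxU | hxU
    · exact (hEserves.2.2.2.2 x ⟨hxU, hx.2⟩).mono Finset.subset_union_left
    · obtain ⟨S, hS, hxS⟩ := mem_iUnion₂.1 hxU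
      exact ((hSserv S hS).2.2.2.2 x ⟨hxS, hx.2⟩).mono
        (Finset.subset_union_right.trans' (Finset.subset_biUnion_of_mem 𝒞S hS))

/-- **Cuts for a free window** [Pawlucki2024, Prop. 2.5, proof, Part II]: a finite family of continuous
semialgebraic cut functions on `ℝᵐ` valid for the window `(γ, δ)` at every point of the free base.
[cite: Pawlucki2024, Prop. 2.5 (proof, Part II)] -/
theorem exists_rcValid_free : ∃ 𝒞 : Finset ((Fin m → ℝ) → ℝ),
    (∀ c ∈ 𝒞, Continuous c ∧ IsSemialgebraicFunOn ℝ univ c) ∧ ∀ x ∈ W.Fr, RCValid W.γ W.δ W.V 𝒞 x := by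
  obtain ⟨𝒞, U, h𝒞, -, -, hFrU, hval⟩ := exists_serves H m W.Fr subset_rfl H.Fr_sa (sdim_le _)
  exact ⟨𝒞, h𝒞, fun x hx => hval x ⟨hFrU hx, hx⟩⟩

end FreeWindow

end FreeWindow

end Literature.ModelTheory.ExponentialFields
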